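import Mathlib
import HarnessLib
import HarnessLib.Audit
import Summits.AtomisticToContinuum.Statement
import Literature.MathematicalPhysics.KineticTheory.LangevinChainNESSHolds
import Literature.MathematicalPhysics.KineticTheory.InhomogeneousChainEnvironment
import Summits.AtomisticToContinuum.FouriersLaw.Theorems.EmbeddedDrudeMourreNessUnique
import Summits.AtomisticToContinuum.FouriersLaw.Theorems.FourierGreenKuboFourierFiniteResponseOfUnique
import HarnessLib.Audit.Status.Attr

/-!
Route: ParabolicBathMap

DORMANT since 2026-08-22T10:28:34Z (reconciler: no traction for 5.3 d (last activity item-evidence-added at 2026-08-17T03:13:24Z); parked, not closed — `ledger route dormant route-AtomisticToContinuum-ParabolicBathMap --off` to reactiva) — unstaffed, not closed; items shared with open routes are served there. `ledger route dormant <id> --off` reactivates.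

# Route ParabolicBathMap — Fourier's law as the parabolic fixed point of the add-one-site bath map —
resistance increments 1/G_{N+1} − 1/G_N → 1/κ, driven by junction locality

It suffices to show X (PARABOLIC ORBIT LAW; realises card
bath-renormalisation-parabolic-fixed-point; D-0027-conforming
re-opening of the retired route BathRenormalisation, whose typed items it keeps verbatim): for
pinnedChain ω₂ lam β γ (all > 0),
under uniqueness of weak steady states, for every T > 0 there is r*(T) ∈ (0,∞) such that for every
steady-state family and every
conductance sequence G — G_N := lim_{δ→0,δ≠0} totalCurrent(μ_{N,T+δ/2,T−δ/2})/((N−1)δ) for N ≥ 2,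
the linear-response CONDUCTANCE
D_N/(N−1) of the N-chain — the RESISTANCE INCREMENTS converge: 1/G_{N+1} − 1/G_N → r*(T); then κ(T)
= 1/r*(T).
Dictionary (card): G_N = g(Φ^{N−1}B_R), the one-site DC conductance functional along the orbit of
the Langevin bath B_R under the
bath map Φ = "attach one pinned anharmonic site" (now in tree: `ChainEnvironment.attach`, orbit
identity `hasConductance_standard_iff`);
X says the orbit approaches the CLOSED fixed point B* (the semi-infinite equilibrium chain seen from
its end, g(B*) = 0) through a
non-degenerate parabolic germ g ↦ g − r*g² + o(g²): one more atom adds one resistance quantum. X is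
decomposed into three nested
exclusions of fixed-point types on the orbit — Recurrence (kills the elliptic/ballistic type) →
ResistanceQuantum (kills degenerate
tangency = anomalous) → ParabolicGerm (kills oscillation and the hyperbolic/insulating type,
identifies r*) — plus ONE typed engine
off the orbit, JunctionLocality (the card's OneSiteSeriesLemma over the landed class 𝔅_T^{m,g₀} of
nearly closed finite Markov
environments), whose orbit shadow is ResistanceQuantum ∧ ParabolicGerm (support LocalityTransfer).
Lean: `∀ ω₂ lam β γ : ℝ, 0 < ω₂ → 0 < lam → 0 < β → 0 < γ → (∀ (N : ℕ) (T_L T_R : ℝ), 0 < T_L → 0 <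
T_R → ∀ μ ν : MeasureTheory.Measure
(Literature.MathematicalPhysics.KineticTheory.HeatConduction.PhaseSpace N),
(Literature.MathematicalPhysics.KineticTheory.HeatConduction.pinnedChain ω₂ lam β γ).IsSteadyState N
T_L T_R μ → (Literature.MathematicalPhysics.KineticTheory.HeatConduction.pinnedChain ω₂ lam β
γ).IsSteadyState N T_L T_R ν → μ = ν) → ∀ T : ℝ, 0 < T → ∃ r : ℝ, 0 < r ∧ ∀ μ : (N : ℕ) → ℝ → ℝ →
MeasureTheory.Measure (Literature.MathematicalPhysics.KineticTheory.HeatConduction.PhaseSpace N), (∀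
(N : ℕ) (T_L T_R : ℝ), 0 < T_L → 0 < T_R →
(Literature.MathematicalPhysics.KineticTheory.HeatConduction.pinnedChain ω₂ lam β γ).IsSteadyState N
T_L T_R (μ N T_L T_R)) → ∀ G : ℕ → ℝ, (∀ N : ℕ, 2 ≤ N → Filter.Tendsto (fun δ : ℝ =>
(Literature.MathematicalPhysics.KineticTheory.HeatConduction.pinnedChain ω₂ lam β γ).totalCurrent (μ
N (T + δ / 2) (T - δ / 2)) / (((N : ℝ) - 1) * δ)) (nhdsWithin 0 {(0 : ℝ)}ᶜ) (nhds (G N))) →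
Filter.Tendsto (fun N : ℕ => (G (N + 1))⁻¹ - (G N)⁻¹) Filter.atTop (nhds r)`

## Assembly
Glue = the deciding theorem `closes` (planner folder SketchGlue.lean/glue.lean, lean check rc 0, no
sorry, axioms
propext/Classical.choice/Quot.sound; ≈ 110 lines of real analysis): fix parameters; clause (i):
existence from the PROVED
`pinnedChain_exists_isSteadyState` (LangevinChainNESSHolds), uniqueness from NessUnique. Clause
(ii): canonical family by choice; its
response sequence D from FiniteResponseOfUnique, conductances G_N := D_N/(N−1) (N ≥ 2) satisfy the
conductance hypothesis
(totalCurrent/((N−1)δ) = (totalCurrent/δ)/(N−1)); OhmicSign and Recurrence discharge the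
antecedents, so ResistanceQuantum gives
eventually a ≤ increments and ParabolicGerm gives increments → r, whence r ≥ a > 0 (ge_of_tendsto);
κ(T) := 1/r. For an arbitrary family
μ: D from FiniteResponseOfUnique, the same r by ParabolicGerm's ∃r ∀family (Recurrence/OhmicSign
again quantify over all families);
telescoping Σ_{i<N}(1/G_{i+1} − 1/G_i) = 1/G_N − 1/G_0 and Filter.Tendsto.cesaro give (1/G_N)/N → r,
hence N·G_N → 1/r, G_N → 0,
D_N = (N−1)G_N → 1/r = κ(T) > 0. The conclusion is the sub-problem Statement decl `FouriersLaw`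
(Summits/AtomisticToContinuum/FouriersLaw/Statement.lean), unfolded to the Literature constant
inside the proof. JunctionLocality is not
a hypothesis of `closes`: it reaches the orbit through LocalityTransfer (JunctionLocality ∧
Recurrence ∧ supports ⇒ X ⇒ FouriersLaw).

Rationale: WHY THIS LINE. Mechanism (card): regroup the (N+1)-chain as ONE thermostatted site facing the
composite environment Φ^N(B_R); all N-dependence of
BLR's clause (ii) (BonettoLebowitzReyBellet2000 §5.3 (33)) is the orbit of the Langevin bath under Φ
on thermal environments at
temperature T, Fourier's law is the statement that Φ is PARABOLIC at the semi-infinite chain with κ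
the inverse quadratic coefficient,
and the catalogued behaviours are the other textbook types of a one-dimensional fixed point: g* > 0
(elliptic Möbius level — harmonic
member, RiederLebowitzLieb1967), hyperbolic at 0 (disordered harmonic chain = random Möbius
products, AjankiHuveneers2011), degenerate
tangency (anomalous, unpinned FPU, LukkarinenSpohn2008). Imported, with explicit dictionary:
one-dimensional dynamics (parabolic germs,
Fatou coordinates) as organising language; the scaling theory of localisation (AbrahamsEtAl1979,
AndersonEtAl1980: composition law of
resistances under added length, Ohmic ⇔ 1/g additive, localised ⇔ multiplicative; g ↔ DC thermal
conductance through one thermostatted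
site, L ↔ N); chain mappings of open systems and the recursive surface-Green's-function iteration of
NEGF phonon transport (WoodsEtAl2014,
WangWangLu2008 = doi:10.1140/epjb/e2008-00195-8: the Gaussian level of Φ is the Möbius map Σ ↦ 1/(ω₂
+ 2 − ω² − Σ) of the boundary
self-energy, elliptic in the band, contracting under dissipation by Schwarz–Pick, fixed point =
semi-infinite lead). What the line does
that the open routes do not: FourierGreenKubo needs an infinite-volume Green–Kubo object and κ =
κ_GK, OddSectorIrreversibility bounds D_N
uniformly and then needs a separate convergence slot (BoundedResponseConverges) — here the
thermodynamic limit is taken along N ↦ N+1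
through ONE junction quantity, the insertion resistance, whose stabilisation gives boundedness,
convergence and positivity of κ at once,
and the engine is typed over INHOMOGENEOUS environments (definition request of the retired route,
landed as
Literature/MathematicalPhysics/KineticTheory/InhomogeneousChainEnvironment.lean), where refuters can
attack it with engineered far
environments and provers can work on a fixed, low-dimensional screening problem. The retired route's
Assembly stopped at the Literature
constant; this route's deciding theorem `closes : NessUnique → FiniteResponseOfUnique → OhmicSign →
Recurrence → ResistanceQuantum →
ParabolicGerm → FouriersLaw` is PROVED in the planner folder (lean check rc 0, axioms
propext/Classical.choice/Quot.sound), clause (i)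
existence coming from the proved `pinnedChain_exists_isSteadyState` instead of a fact hypothesis.
Negatives index: 6 refuted
statements on the summit, none on FouriersLaw (2026-08-15).

RANKED CRUXES. #0 BathOrbitParabolic (target) — X of § Thesis (identical signature to retired
stmt-3319): under weak-NESS uniqueness, for every T > 0 there is r > 0 such that for every
steady-state family and every conductance sequence G (N ≥ 2) the resistance increments 1/G_{N+1} −
1/G_N → r; κ(T) = 1/r. Cheap from the cruxes: r from ParabolicGerm, a from ResistanceQuantum, r ≥ a
> 0 along the canonical family (pinnedChain_exists_isSteadyState + NessUnique +
FiniteResponseOfUnique + OhmicSign + Recurrence) — ≈ 40 lines of Filter algebra, done inside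
`closes`. (why it might fail: strictly stronger than FouriersLaw (which needs only R_N/N → 1/κ):
increments may tend to 0 (anomalous κ_N → ∞ despite pinning), oscillate at O(1) (coherent
finite-size structure surviving at T > 0), or G_N ↛ 0 (hidden conserved quantity, Mazur).)
[BonettoLebowitzReyBellet2000, AokiKusnezov2000, AbrahamsEtAl1979, AndersonEtAl1980,
AjankiHuveneers2011]
#2 JunctionLocality (crux) — (card item OneSiteSeriesLemma, typed over the landed finite-Markov
environment class; the ENGINE) for all parameters > 0 and T > 0 there is r > 0 (= r*(T) = 1/κ(T))
such that for every ε > 0 there are a head length m and a closure threshold g₀ > 0 with: for EVERY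
chain environment E in 𝔅_T^{m,g₀} = `ChainEnvironment.nearlyClosed U V γ T m g₀` (far bath coupling
> 0, first m sites/bonds standard pinnedChain sites, every one-site conductance at T ≤ g₀; far sites
and bonds ARBITRARY) and all conductances g of E and g' of ΦE = `E.attach U V` (contact coupling γ,
U = pinnedChain.U, V = pinnedChain.V) with g, g' > 0: |1/g' − 1/g − r| ≤ ε. "One more standard site
in front of a nearly closed environment with a long standard head adds one resistance quantum,
whatever lies behind the head" — locality (screening) of the insertion resistance; continuity of the
card's r(·) at B* in the DC topology generated by (head length, conductance). Along the orbit E =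
standard n it yields ResistanceQuantum ∧ ParabolicGerm (LocalityTransfer). Vacuity audit: an E whose
composite has no steady-state family lies outside the class (every g would be a conductance); an E
without a well-defined conductance (non-unique families with different currents) imposes nothing;
disconnected far parts give g = 0 and are excluded by g > 0. [difficulty: open-problem] (why it
might fail: uniformity over ALL far environments: a far part with long memory (integrable island,
near-degenerate weak link, spurious non-thermal weak steady states) may imprint on the port beyond
any fixed head m at fixed g₀ — screening length not uniform in the class; then restate over a tamer
class.) [BonettoLebowitzReyBellet2000 §5.3 and §7, AokiKusnezov2000, WoodsEtAl2014, WangWangLu2008,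
doi:10.1103/physreve.103.052113, CuneoEckmannHairerReyBellet2018]
#3 ParabolicGerm (crux) — (card items OneSiteSeriesLemma ∘ OrbitConvergence restricted to the orbit;
identical signature to retired stmt-3320, refuter-checked 2026-08-15) GIVEN that the orbit enters
every DC-neighbourhood of the closed environment (G_N → 0) and G_N > 0 (N ≥ 2), the resistance
increments 1/G_{N+1} − 1/G_N CONVERGE to a real limit r (Φ has a C² germ at B* along the orbit;
quantifiers ∀T ∃r ∀family, legitimate under uniqueness). With ResistanceQuantum r ≥ a > 0 and κ =
1/r. Excludes the oscillatory and the hyperbolic/insulating (increments → ∞) types. Robust to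
power-law finite-size corrections D_N = κ + cN^{−a} (increments still → 1/κ). [deps: Recurrence,
OhmicSign] [difficulty: open-problem] (why it might fail: a persistent O(1) finite-size oscillation
of R_N − N/κ (period-2 band-edge or contact resonances surviving at T > 0) leaves Fourier true but
the increments divergent; and DC-continuity of r at B* IS N-uniform time-integrability of the
junction force correlations.) [BonettoLebowitzReyBellet2000 §5.3 and §7, AokiKusnezov2000,
WoodsEtAl2014, Dhar2008 §3, AndersonEtAl1980, LeeDadswell2015]
#4 ResistanceQuantum (crux) — (identical signature to retired stmt-3321, refuter-checked) GIVEN G_N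
→ 0 and G_N > 0 (N ≥ 2), eventually every added site costs at least a fixed resistance quantum: ∃ a
> 0 with 1/G_{N+1} − 1/G_N ≥ a for all large N (r bounded away from 0 near B*: NON-DEGENERATE
quadratic tangency; quantifiers ∀T ∃a ∀family). Consequences: R_N ≥ aN/2 eventually, hence sup_N D_N
< ∞ (HasBoundedResponse along the unique family) and eventual monotonicity of G_N. Excludes the
anomalous (superdiffusive, tangency order < 2) type. [deps: Recurrence, OhmicSign] [difficulty:
open-problem] (why it might fail: superdiffusion at some (T, ω₂, lam, β) would send the increments
to 0 (believed excluded by pinning, AokiLukkarinenSpohn2006, unproved); or G_N fails to be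
eventually monotone (a non-positive increment infinitely often) even with Ohmic averages.)
[AokiLukkarinenSpohn2006, LepriLiviPoliti2003, BonettoLebowitzReyBellet2000 §6.3, decl
Literature.Barriers.AtomisticToContinuum.HasBoundedResponse, decl
Literature.Barriers.AtomisticToContinuum.LukkarinenSpohn2008_lemma41]
#5 Recurrence (crux) — (card item Recurrence, g(B*) = 0, on the orbit; identical signature to
retired stmt-3322) the chain conductance tends to zero, G_N(T) → 0 as N → ∞, for every steady-state
family under uniqueness — the semi-infinite pinned anharmonic chain is CLOSED at DC, no ballistic
channel; equivalently D_N = o(N). Strictly weaker than HasBoundedResponse and than the conjunct; the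
first deliverable and the entrance ticket to the parabolic neighbourhood. Excludes the
elliptic/ballistic type (the harmonic member fails exactly here: G_N → c_∞ > 0). [difficulty:
open-problem] (why it might fail: a local conserved quantity of the quartic pinned chain overlapping
the energy current (Mazur ⇒ Drude weight > 0 ⇒ G_N ↛ 0), or exact non-radiating moving breathers;
none is known, but integrability is excluded only numerically.) [Mazur1969, decl
Literature.Barriers.AtomisticToContinuum.Mazur1969_inequality, Dhar2008, RiederLebowitzLieb1967,
decl Literature.Barriers.AtomisticToContinuum.HarmonicChainBallisticFlux, KunduDharNarayan2009]
#9 OhmicSign (support) — (identical signature to retired stmt-3323) strict positivity of the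
finite-N conductance, G_N(T) > 0 for all N ≥ 2, every steady-state family under uniqueness
(non-degeneracy of the finite-volume Kubo variance of the contact power w_L = γ(T − p_0²): w_L is
not a coboundary L h with ∂_p h = 0 on the bath momenta). Print-level routine given the
finite-volume Green–Kubo formula (ReyBellet2003 Rem 4.4 (56)) and strict entropy production
(EckmannPilletReyBellet1999b); the Markov semigroup of the chain is in tree
(OscillatorChain.transitionKernel). Load-bearing: antecedent of ResistanceQuantum and ParabolicGerm
and hypothesis of `closes`. [difficulty: L] [ReyBellet2003, EckmannPilletReyBellet1999b,
CuneoEckmannHairerReyBellet2018]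
#9 NessUnique (support) — (shared item stmt-AtomisticToContinuum-0741, identical signature)
uniqueness of the weak steady state in the class IsSteadyState for pinnedChain, all N and T_L, T_R >
0 (print: CuneoEckmannHairerReyBellet2018 Thm 2.13(1) for the semigroup, plus the Fokker–Planck
identification lemma, Echeverría/Ethier–Kurtz 4.9.17). With the PROVED
pinnedChain_exists_isSteadyState it is clause (i). [difficulty: L] [CuneoEckmannHairerReyBellet2018,
Carmona2007]
#9 FiniteResponseOfUnique (support) — (shared item stmt-AtomisticToContinuum-0717, identical
signature) under uniqueness, for every steady-state family, T > 0 and N the finite-N response limit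
D_N = lim_{δ→0,δ≠0} totalCurrent(μ_{N,T+δ/2,T−δ/2})/δ exists (differentiability of NESS expectations
in the bath temperatures at equilibrium; finite-volume Green–Kubo). Supplies the conductance
sequences G_N = D_N/(N−1). [difficulty: L] [ReyBellet2003, HairerMajda2009,
CuneoEckmannHairerReyBellet2018]
#9 LocalityTransfer (support) — (glue of the foreseen split ParabolicGerm ⇐ JunctionLocality →
OrbitTail; provable now) JunctionLocality → ResistanceQuantum ∧ ParabolicGerm: write N = n+1; E_n :=
ChainEnvironment.standard U V γ n is Φ^[n](bath γ) (iterate_attach_bath) and its composite IS the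
(n+1)-chain (composite_standard), so by hasConductance_standard_iff and uniqueness (families agree
for |δ| < 2T, limits along 𝓝[≠]0 coincide) the conductance of E_n exists and equals G_{n+1}; G → 0
puts E_n in nearlyClosed m g₀ for large n (standard_mem_nearlyClosed_iff), E_n.attach = E_{n+1}
(attach_standard), positivity from the antecedent; hence eventually |1/G_{N+1} − 1/G_N − r| ≤ ε:
increments → r (ParabolicGerm) and eventually ≥ r/2 =: a (ResistanceQuantum). Bridges elaborated in
the planner folder (CheckBridge.lean rc 0). [difficulty: provable-now]
[BonettoLebowitzReyBellet2000, CuneoEckmannHairerReyBellet2018]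

TWO-LAYER PLAN. Foreseen glued splits (k ≤ 3, depth 1), filed only after a crux closes:
ParabolicGerm ⇐ JunctionLocality → OrbitTail → ParabolicGerm
is ALREADY expressed by the support LocalityTransfer (OrbitTail = "the orbit eventually lies in
𝔅_T^{m,g₀} with positive conductances",
immediate from Recurrence + OhmicSign). JunctionLocality ⇐ OneSiteAveraging (the insertion
resistance of one standard site in front of
an environment E of the class equals a functional r(E) of the port force statistics: separation of
scales for ONE anharmonic site between
a Markov contact and a slow DC trickle) → HeadScreening (|r(E) − r(E')| ≤ ε whenever E, E' share a
standard head of length m(ε):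
exponential forgetfulness of the equilibrium dynamics of m anharmonic sites as seen from the port) →
JunctionLocality. ResistanceQuantum
⇐ InsertionCostLowerBound (N-uniform lower bound on the insertion resistance in front of any nearly
closed environment of the class) →
OrbitTail → ResistanceQuantum. Recurrence ⇐ NoHiddenCharge → OpenChainMazurBridge (vanishing Drude
weight of the open chain ⇒ G_N → 0;
cards open-chain-mazur-bridge, no-hidden-charges-hydro-projection) → Recurrence. The Gaussian level
— Φ as the Möbius map
Σ ↦ 1/(ω₂ + 2 − ω² − Σ), elliptic in the band, Schwarz–Pick contraction under Im > 0 — is the model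
each child is calibrated against.

KILL CRITERIA. ¬Recurrence (G_N ↛ 0 along the unique family: a ballistic component) refutes the
conjunct itself (hasBoundedResponse_of_fouriersLawFor):
close refuted:Recurrence and file ¬FouriersLaw with the witness. ¬ResistanceQuantum by increments →
0 (anomalous scaling) likewise
refutes FouriersLaw (κ_N → ∞); ¬ResistanceQuantum by non-monotone G_N with Ohmic Cesàro averages
forces a pivot — restate with averaged
increments, at which point the line degenerates into the Fekete/additivity line (cards
fekete-resistance-subadditivity,
insertion-cost-superadditive-half) and should be closed superseded. ¬ParabolicGerm by bounded
non-convergent increments with convergent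
averages: pivot to the averaged germ; ¬ParabolicGerm by increments → ∞: FouriersLaw is false (κ = 0,
insulating). ¬JunctionLocality by
an ENGINEERED far environment (integrable island, spurious weak steady states) while the orbit
statements stand: the engine is
misstated, not the line — restate JunctionLocality over a tamer far class (far data = standard sites
and weak links, or pinnedChain-type
polynomial potentials) as a new item; ¬JunctionLocality witnessed ALONG THE ORBIT is ¬ParabolicGerm
or ¬ResistanceQuantum (above). If
FourierGreenKubo or OddSectorIrreversibility closes the conjunct first, this route is mooted (close
superseded); its cruxes stay as
finer statements about the approach to the limit.

NOT DECOMPOSED YET. The semi-infinite equilibrium chain seen from its end (B* as an object: law of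
the end-site process under the half-line dynamics,
LanfordLebowitzLieb1977 / Buttà et al.) and OrbitConvergence stated literally — long-horizon
definition, not requested now; B* enters only
through the orbit and the class 𝔅_T^{m,g₀}. The children OneSiteAveraging / HeadScreening /
InsertionCostLowerBound (Two-layer plan).
Calibrations for idle provers later (support, not filed now): N = 1 (G_1 = γ/2 exactly), N = 2, the
harmonic consistency check (elliptic
Möbius level: increments → 0, G_N → c_∞ > 0, so ParabolicGerm/ResistanceQuantum hold vacuously there
and every proof of Recurrence must
use lam, β > 0). The finite-size germ fingerprint (analytic germ ⇒ R_N − r*N ∼ c·log N; hydrodynamic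
t^{−3/2} tail, LeeDadswell2015 ⇒
c·√N) — a numerical deliverable, not an item. γ-independence and T-continuity of r* (other cards).

CHEAPEST FALSIFIER. Two kit-sized numerics (equilibrium finite-N Green–Kubo or NEMD, pinnedChain
with ω₂ = lam = β = γ = 1, T = 1), both at O(10 %)
precision because they probe O(1) quantities at SMALL N, not O(1/N) increments at large N: (1)
ORBIT: G_N for N = 2…16; the increments
1/G_{N+1} − 1/G_N are O(1/κ) against 1/G_N = O(N/κ), resolvable at ≈ 3 % relative error on G_N —
they must settle to a constant (a
plateau of G_N kills Recurrence and the conjunct; increments drifting to 0 kill ResistanceQuantum; a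
reproducible period-2 or wandering
O(1) oscillation kills ParabolicGerm). (2) ENGINE: weak-link environments E = [m standard
sites]–[one bond ε·V, ε ∈ {0.1, 0.3}]–[4
standard sites]–bath, m ∈ {2, 4, 8}: the insertion resistance 1/g(ΦE) − 1/g(E) must approach the
orbit value as m grows although g(E) is
suppressed by the link — an m-independent offset kills JunctionLocality as typed (pivot to a tamer
class). Not run here (one-shot
planner); recommended as the refuter's first kit job. Lookup: is G_N > 0 (OhmicSign) printed for
Langevin baths
(EckmannPilletReyBellet1999b: μ(Φ) > 0 iff T_L > T_R for their reservoirs; first order needs the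
Kubo variance ≠ 0)?

NUMBERS. N = 1: G_1 = γ/2 exactly (one site between two Ornstein–Uhlenbeck contacts; card). Harmonic
member lam = β = 0: G_N → c_∞(ω₂, γ) > 0,
increments → 0 (RiederLebowitzLieb1967; decl HarmonicChainBallisticFlux, not_hasBoundedResponse) —
elliptic type. Disordered harmonic
chain: resistance exponential in N (hyperbolic type; AjankiHuveneers2011, decl
AjankiHuveneers2011_scaling). φ⁴ NEMD (AokiKusnezov2000
pp. 3–4, eqs. (10)–(11)): boundary jump T_c − T_c⁰ ≃ α⟨J⟩ with α = 2.6(1), thermostat-dependent,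
bulk κ(T) thermostat-independent, i.e.
R_N ≈ 2α + N/κ at O(1) resolution — consistent with X, not resolving it. Kinetic regime: κ ∼ T^{−2}
at weak anharmonicity / low T
(AokiLukkarinenSpohn2006), so r*(T) → 0 and the parabolic neighbourhood (m, g₀) degrades as T → 0.
Finite-size corrections of
momentum-non-conserving chains are governed by the ω^{1/2} cusp of the current power spectrum
(LeeDadswell2015), i.e. D_N = κ − c/√N,
compatible with increments → 1/κ. Items at open: 10 (target, 4 cruxes, 4 support, assembly).

DEFINITION REQUESTS. None new. LANDED since the retired route:
Literature/MathematicalPhysics/KineticTheory/InhomogeneousChainEnvironment.lean —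
InhomogeneousChain (two bath couplings), ChainEnvironment, bath (B_R), attach (Φ), standard (Φ^k
B_R, iterate_attach_bath), composite,
HasConductance (g as a predicate over all steady-state families), IsStandardUpTo, nearlyClosed
(𝔅_T^{m,g₀}), orbit identity
hasConductance_standard_iff — used by JunctionLocality and LocalityTransfer (imports above). Not
requested (long horizon): the
half-line end process hosting B* literally. Bib: LeeDadswell2015 (doi:10.1103/physreve.91.012138)
and WangWangLu2008
(doi:10.1140/epjb/e2008-00195-8) submitted with `ledger bib add` from the planner folder (refs.bib).

Novelty: Searches (2026-08-15, this session): `lit search --hybrid "interface thermal resistance anharmonic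
chain single junction locality Kapitza
resistance length independence nonequilibrium Langevin"` (12 held books, textbook Kapitza/NEGF
material only: kaviany2014, gaspard2022,
balakrishnan2020 …); `lit search --source crossref "Kapitza thermal boundary resistance anharmonic
chain nonequilibrium Langevin length
independent contact resistance"` (10; relevant: doi:10.1103/physreve.103.052113 Gendelman–Paul 2021,
defect Kapitza resistance in
chain models — a single-junction resistance but no length recursion and no locality statement); `lit
search --source crossref
"Lee-Dadswell universality classes … finite-size corrections current power spectrum"` (→
doi:10.1103/physreve.91.012138,
doi:10.1103/physreve.91.032102, now cited as LeeDadswell2015); `lit search --source crossref "Wang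
Wang Lü … nonequilibrium Green's
function review"` + direct DOI (doi:10.1140/epjb/e2008-00195-8, cited as WangWangLu2008: recursive
surface Green's function = the
Gaussian level of Φ); `lit frontier AtomisticToContinuum --since 2023` (30 rows; heat-conduction
descendants arXiv:2310.13338 (Invent.
Math. 2026, deterministic bulk + chaotic forcing) and arXiv:2604.14056 — neither recursive in N);
`lit galaxy search "surface Green's
function recursion semi-infinite lead phonon thermal conductance fixed point" --star all` (0), `lit
galaxy search "semi-infinite chain as
a heat bath" --star all` (0), `lit galaxy se  [refs: 10.1103/physreve.103.052113, 10.1103/physreve.91.012138, 10.1103/physreve.91.032102, 10.1140/epjb/e2008-00195-8, 2310.13338, 2604.14056, doi:10.1103/physreve.103.052113, doi:10.1103/physreve.91.012138, doi:10.1103/physreve.91.032102, doi:10.1140/epjb/e2008-00195-8, LeeDadswell2015, WangWangLu2008, AbrahamsEtAl1979, AndersonEtAl1980, WoodsEtAl2014, AjankiHuveneers2011, AokiKusnezov2000]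

Barriers (technique_class: environment-map-recursion parabolic-fixed-point locality): - technique_class: environment-map-recursion parabolic-fixed-point locality
- Literature.Barriers.AtomisticToContinuum.HasBoundedResponse: not evaded — ResistanceQuantum
implies it along the unique family (necessary waypoint, hasBoundedResponse_of_fouriersLawFor); the
line displaces the N-dependence from a fixed-N analysis to ONE junction (JunctionLocality: insertion
resistance in front of a nearly closed environment); the bet is that this is a fixed,
low-dimensional screening/averaging problem, not an N-body estimate.
- Literature.Barriers.AtomisticToContinuum.HarmonicChainBallisticFlux: consistent and shaping — the
harmonic member is the elliptic type: Recurrence fails (G_N → c_∞ > 0, not_hasBoundedResponse) while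
ResistanceQuantum/ParabolicGerm hold vacuously; every proof of Recurrence and of JunctionLocality
must use lam, β > 0 (the standard head is anharmonic by definition).
- Literature.Barriers.AtomisticToContinuum.Mazur1969_inequality: applies to Recurrence — a conserved
quantity overlapping the current gives a Drude weight and G_N ↛ 0; first kill criterion, detected
not hidden.
- Literature.Barriers.AtomisticToContinuum.BeckerMenegaki2022_gapClosing: no spectral gap or
relaxation RATE of the N-chain is used; the parabolic fixed point has multiplier 1 — the
recursion-side image of the closing gap — and JunctionLocality asks for DC (time-integrated)
screening at one junction, not a gap.
- Literature.Barriers.AtomisticToContinuum.LowTemperatureWeakAnharmonicity: concede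

History (route lifecycle, newest last):
- 2026-08-22T10:28:34Z · DORMANT — reconciler: no traction for 5.3 d (last activity item-evidence-added at 2026-08-17T03:13:24Z); parked, not closed — `ledger route dormant route-AtomisticToConti (operator:999:3592903)

sub-problem: FouriersLaw · status: dormant · opened planner-plancard-AtomisticToContinuum-Fourier-74caf047-g2-0 2026-08-15T18:46:02Z · rev 1 · ledger route-AtomisticToContinuum-ParabolicBathMap
GENERATED by the gate from the ledger (D-0016/17). Provers cite these decls: `theorem foo : Summit.AtomisticToContinuum.FouriersLaw.Theses.ParabolicBathMap.<Decl> := …` in Summits/AtomisticToContinuum/FouriersLaw/Theorems/<Name>.lean.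
-/

namespace Summit.AtomisticToContinuum.FouriersLaw.Theses.ParabolicBathMap

open scoped BigOperators Topology Manifold Classical MeasureTheory ProbabilityTheory Matrix InnerProductSpace ComplexConjugate ContinuousMap
open Filter Set Function TopologicalSpace MeasureTheory

attribute [summit_statement] _root_.FouriersLaw

/-- item stmt-AtomisticToContinuum-11919 · target · rank 0 · open · by planner
why it might fail: strictly stronger than FouriersLaw (which needs only R_N/N → 1/κ): increments may tend to 0 (anomalous κ_N → ∞ despite pinning), oscillate at O(1) (coherent finite-size structure surviving at T > 0), or G_N ↛ 0 (hidden conserved quantity, Mazur).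
sources: BonettoLebowitzReyBellet2000, AokiKusnezov2000, AbrahamsEtAl1979, AndersonEtAl1980, AjankiHuveneers2011
[target] X of § Thesis (identical signature to retired stmt-3319): under weak-NESS uniqueness, for
every T > 0 there is r > 0 such that for every steady-state family and every conductance sequence G
(N ≥ 2) the resistance increments 1/G_{N+1} − 1/G_N → r; κ(T) = 1/r. Cheap from the cruxes: r from
ParabolicGerm, a from ResistanceQuantum, r ≥ a > 0 along the canonical family
(pinnedChain_exists_isSteadyState + NessUnique + FiniteResponseOfUnique + OhmicSign + Recurrence) —
≈ 40 lines of Filter algebra, done inside `closes`. -/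
@[route_item "route-AtomisticToContinuum-ParabolicBathMap"]
def BathOrbitParabolic : Prop :=
  ∀ ω₂ lam β γ : ℝ, 0 < ω₂ → 0 < lam → 0 < β → 0 < γ → (∀ (N : ℕ) (T_L T_R : ℝ), 0 < T_L → 0 < T_R → ∀ μ ν : MeasureTheory.Measure (Literature.MathematicalPhysics.KineticTheory.HeatConduction.PhaseSpace N), (Literature.MathematicalPhysics.KineticTheory.HeatConduction.pinnedChain ω₂ lam β γ).IsSteadyState N T_L T_R μ → (Literature.MathematicalPhysics.KineticTheory.HeatConduction.pinnedChain ω₂ lam β γ).IsSteadyState N T_L T_R ν → μ = ν) → ∀ T : ℝ, 0 < T → ∃ r : ℝ, 0 < r ∧ ∀ μ : (N : ℕ) → ℝ → ℝ → MeasureTheory.Measure (Literature.MathematicalPhysics.KineticTheory.HeatConduction.PhaseSpace N), (∀ (N : ℕ) (T_L T_R : ℝ), 0 < T_L → 0 < T_R → (Literature.MathematicalPhysics.KineticTheory.HeatConduction.pinnedChain ω₂ lam β γ).IsSteadyState N T_L T_R (μ N T_L T_R)) → ∀ G : ℕ → ℝ, (∀ N : ℕ, 2 ≤ N → Filter.Tendsto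 (fun δ : ℝ => (Literature.MathematicalPhysics.KineticTheory.HeatConduction.pinnedChain ω₂ lam β γ).totalCurrent (μ N (T + δ / 2) (T - δ / 2)) / (((N : ℝ) - 1) * δ)) (nhdsWithin 0 {(0 : ℝ)}ᶜ) (nhds (G N))) → Filter.Tendsto (fun N : ℕ => (G (N + 1))⁻¹ - (G N)⁻¹) Filter.atTop (nhds r)

/-- item stmt-AtomisticToContinuum-11920 · crux · rank 2 · open · by planner
why it might fail: uniformity over ALL far environments: a far part with long memory (integrable island, near-degenerate weak link, spurious non-thermal weak steady states) may imprint on the port beyond any fixed head m at fixed g₀ — screening length not uniform in the class; then restate over a tamer class.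
sources: BonettoLebowitzReyBellet2000 §5.3 and §7, AokiKusnezov2000, WoodsEtAl2014, WangWangLu2008, doi:10.1103/physreve.103.052113, CuneoEckmannHairerReyBellet2018
[crux] (card item OneSiteSeriesLemma, typed over the landed finite-Markov environment class; the
ENGINE) for all parameters > 0 and T > 0 there is r > 0 (= r*(T) = 1/κ(T)) such that for every ε > 0
there are a head length m and a closure threshold g₀ > 0 with: for EVERY chain environment E in
𝔅_T^{m,g₀} = `ChainEnvironment.nearlyClosed U V γ T m g₀` (far bath coupling > 0, first m
sites/bonds standard pinnedChain sites, every one-site conductance at T ≤ g₀; far sites and bonds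
ARBITRARY) and all conductances g of E and g' of ΦE = `E.attach U V` (contact coupling γ, U =
pinnedChain.U, V = pinnedChain.V) with g, g' > 0: |1/g' − 1/g − r| ≤ ε. "One more standard site in
front of a nearly closed environment with a long standard head adds one resistance quantum, whatever
lies behind the head" — locality (screening) of the insertion resistance; continuity of the card's
r(·) at B* in the DC topology generated by (head length, conductance). Along the orbit E = standard
n it yields ResistanceQuantum ∧ ParabolicGerm (LocalityTransfer). Vacuity audit: an E whose
composite has no steady-state family lies outside the class (every g would be a conductance); an E
without a well-defined conductance -/
@[route_item "route-AtomisticToContinuum-ParabolicBathMap"]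
def JunctionLocality : Prop :=
  ∀ ω₂ lam β γ : ℝ, 0 < ω₂ → 0 < lam → 0 < β → 0 < γ → ∀ T : ℝ, 0 < T → ∃ r : ℝ, 0 < r ∧ ∀ ε : ℝ, 0 < ε → ∃ m : ℕ, ∃ g₀ : ℝ, 0 < g₀ ∧ ∀ E : Literature.MathematicalPhysics.KineticTheory.HeatConduction.ChainEnvironment, E ∈ Literature.MathematicalPhysics.KineticTheory.HeatConduction.ChainEnvironment.nearlyClosed (Literature.MathematicalPhysics.KineticTheory.HeatConduction.pinnedChain ω₂ lam β γ).U (Literature.MathematicalPhysics.KineticTheory.HeatConduction.pinnedChain ω₂ lam β γ).V γ T m g₀ → ∀ g g' : ℝ, E.HasConductance (Literature.MathematicalPhysics.KineticTheory.HeatConduction.pinnedChain ω₂ lam β γ).U (Literature.MathematicalPhysics.KineticTheory.HeatConduction.pinnedChain ω₂ lam β γ).V γ T g → (E.attach (Literature.MathematicalPhysics.KineticTheory.HeatConduction.pinnedChain ω₂ lam β γ).U (Literature.MathematicalPhysics.KineticTheory.HeatConduction.pinnedChain ω₂ lam β γ).V).HasConductance (Literature.MathematicalPhysics.KineticTheory.HeatConduction.pinnedChain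 ω₂ lam β γ).U (Literature.MathematicalPhysics.KineticTheory.HeatConduction.pinnedChain ω₂ lam β γ).V γ T g' → 0 < g → 0 < g' → |g'⁻¹ - g⁻¹ - r| ≤ ε

/-- item stmt-AtomisticToContinuum-11921 · crux · rank 3 · open · by planner
why it might fail: a persistent O(1) finite-size oscillation of R_N − N/κ (period-2 band-edge or contact resonances surviving at T > 0) leaves Fourier true but the increments divergent; and DC-continuity of r at B* IS N-uniform time-integrability of the junction force correlations.
sources: BonettoLebowitzReyBellet2000 §5.3 and §7, AokiKusnezov2000, WoodsEtAl2014, Dhar2008 §3, AndersonEtAl1980, LeeDadswell2015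
[crux] (card items OneSiteSeriesLemma ∘ OrbitConvergence restricted to the orbit; identical
signature to retired stmt-3320, refuter-checked 2026-08-15) GIVEN that the orbit enters every
DC-neighbourhood of the closed environment (G_N → 0) and G_N > 0 (N ≥ 2), the resistance increments
1/G_{N+1} − 1/G_N CONVERGE to a real limit r (Φ has a C² germ at B* along the orbit; quantifiers ∀T
∃r ∀family, legitimate under uniqueness). With ResistanceQuantum r ≥ a > 0 and κ = 1/r. Excludes the
oscillatory and the hyperbolic/insulating (increments → ∞) types. Robust to power-law finite-size
corrections D_N = κ + cN^{−a} (increments still → 1/κ). [deps: Recurrence, OhmicSign] [difficulty: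
open-problem] -/
@[route_item "route-AtomisticToContinuum-ParabolicBathMap", crux]
def ParabolicGerm : Prop :=
  ∀ ω₂ lam β γ : ℝ, 0 < ω₂ → 0 < lam → 0 < β → 0 < γ → (∀ (N : ℕ) (T_L T_R : ℝ), 0 < T_L → 0 < T_R → ∀ μ ν : MeasureTheory.Measure (Literature.MathematicalPhysics.KineticTheory.HeatConduction.PhaseSpace N), (Literature.MathematicalPhysics.KineticTheory.HeatConduction.pinnedChain ω₂ lam β γ).IsSteadyState N T_L T_R μ → (Literature.MathematicalPhysics.KineticTheory.HeatConduction.pinnedChain ω₂ lam β γ).IsSteadyState N T_L T_R ν → μ = ν) → ∀ T : ℝ, 0 < T → ∃ r : ℝ, ∀ μ : (N : ℕ) → ℝ → ℝ → MeasureTheory.Measure (Literature.MathematicalPhysics.KineticTheory.HeatConduction.PhaseSpace N), (∀ (N : ℕ) (T_L T_R : ℝ), 0 < T_L → 0 < T_R → (Literature.MathematicalPhysics.KineticTheory.HeatConduction.pinnedChain ω₂ lam β γ).IsSteadyState N T_L T_R (μ N T_L T_R)) → ∀ G : ℕ → ℝ, (∀ N : ℕ, 2 ≤ N → Filter.Tendsto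 (fun δ : ℝ => (Literature.MathematicalPhysics.KineticTheory.HeatConduction.pinnedChain ω₂ lam β γ).totalCurrent (μ N (T + δ / 2) (T - δ / 2)) / (((N : ℝ) - 1) * δ)) (nhdsWithin 0 {(0 : ℝ)}ᶜ) (nhds (G N))) → Filter.Tendsto G Filter.atTop (nhds 0) → (∀ N : ℕ, 2 ≤ N → 0 < G N) → Filter.Tendsto (fun N : ℕ => (G (N + 1))⁻¹ - (G N)⁻¹) Filter.atTop (nhds r)

/-- item stmt-AtomisticToContinuum-11922 · crux · rank 4 · open · by planner
why it might fail: superdiffusion at some (T, ω₂, lam, β) would send the increments to 0 (believed excluded by pinning, AokiLukkarinenSpohn2006, unproved); or G_N fails to be eventually monotone (a non-positive increment infinitely often) even with Ohmic averages.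
sources: AokiLukkarinenSpohn2006, LepriLiviPoliti2003, BonettoLebowitzReyBellet2000 §6.3, decl Literature.Barriers.AtomisticToContinuum.HasBoundedResponse, decl Literature.Barriers.AtomisticToContinuum.LukkarinenSpohn2008_lemma41
[crux] (identical signature to retired stmt-3321, refuter-checked) GIVEN G_N → 0 and G_N > 0 (N ≥
2), eventually every added site costs at least a fixed resistance quantum: ∃ a > 0 with 1/G_{N+1} −
1/G_N ≥ a for all large N (r bounded away from 0 near B*: NON-DEGENERATE quadratic tangency;
quantifiers ∀T ∃a ∀family). Consequences: R_N ≥ aN/2 eventually, hence sup_N D_N < ∞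
(HasBoundedResponse along the unique family) and eventual monotonicity of G_N. Excludes the
anomalous (superdiffusive, tangency order < 2) type. [deps: Recurrence, OhmicSign] [difficulty:
open-problem] -/
@[route_item "route-AtomisticToContinuum-ParabolicBathMap", crux]
def ResistanceQuantum : Prop :=
  ∀ ω₂ lam β γ : ℝ, 0 < ω₂ → 0 < lam → 0 < β → 0 < γ → (∀ (N : ℕ) (T_L T_R : ℝ), 0 < T_L → 0 < T_R → ∀ μ ν : MeasureTheory.Measure (Literature.MathematicalPhysics.KineticTheory.HeatConduction.PhaseSpace N), (Literature.MathematicalPhysics.KineticTheory.HeatConduction.pinnedChain ω₂ lam β γ).IsSteadyState N T_L T_R μ → (Literature.MathematicalPhysics.KineticTheory.HeatConduction.pinnedChain ω₂ lam β γ).IsSteadyState N T_L T_R ν → μ = ν) → ∀ T : ℝ, 0 < T → ∃ a : ℝ, 0 < a ∧ ∀ μ : (N : ℕ) → ℝ → ℝ → MeasureTheory.Measure (Literature.MathematicalPhysics.KineticTheory.HeatConduction.PhaseSpace N), (∀ (N : ℕ) (T_L T_R : ℝ), 0 < T_L → 0 < T_R → (Literature.MathematicalPhysics.KineticTheory.HeatConduction.pinnedChain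 ω₂ lam β γ).IsSteadyState N T_L T_R (μ N T_L T_R)) → ∀ G : ℕ → ℝ, (∀ N : ℕ, 2 ≤ N → Filter.Tendsto (fun δ : ℝ => (Literature.MathematicalPhysics.KineticTheory.HeatConduction.pinnedChain ω₂ lam β γ).totalCurrent (μ N (T + δ / 2) (T - δ / 2)) / (((N : ℝ) - 1) * δ)) (nhdsWithin 0 {(0 : ℝ)}ᶜ) (nhds (G N))) → Filter.Tendsto G Filter.atTop (nhds 0) → (∀ N : ℕ, 2 ≤ N → 0 < G N) → ∀ᶠ N : ℕ in Filter.atTop, a ≤ (G (N + 1))⁻¹ - (G N)⁻¹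

/-- item stmt-AtomisticToContinuum-11923 · crux · rank 5 · open · by planner
why it might fail: a local conserved quantity of the quartic pinned chain overlapping the energy current (Mazur ⇒ Drude weight > 0 ⇒ G_N ↛ 0), or exact non-radiating moving breathers; none is known, but integrability is excluded only numerically.
sources: Mazur1969, decl Literature.Barriers.AtomisticToContinuum.Mazur1969_inequality, Dhar2008, RiederLebowitzLieb1967, decl Literature.Barriers.AtomisticToContinuum.HarmonicChainBallisticFlux, KunduDharNarayan2009
[crux] (card item Recurrence, g(B*) = 0, on the orbit; identical signature to retired stmt-3322) the
chain conductance tends to zero, G_N(T) → 0 as N → ∞, for every steady-state family under uniqueness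
— the semi-infinite pinned anharmonic chain is CLOSED at DC, no ballistic channel; equivalently D_N
= o(N). Strictly weaker than HasBoundedResponse and than the conjunct; the first deliverable and the
entrance ticket to the parabolic neighbourhood. Excludes the elliptic/ballistic type (the harmonic
member fails exactly here: G_N → c_∞ > 0). [difficulty: open-problem] -/
@[route_item "route-AtomisticToContinuum-ParabolicBathMap", crux]
def Recurrence : Prop :=
  ∀ ω₂ lam β γ : ℝ, 0 < ω₂ → 0 < lam → 0 < β → 0 < γ → (∀ (N : ℕ) (T_L T_R : ℝ), 0 < T_L → 0 < T_R → ∀ μ ν : MeasureTheory.Measure (Literature.MathematicalPhysics.KineticTheory.HeatConduction.PhaseSpace N), (Literature.MathematicalPhysics.KineticTheory.HeatConduction.pinnedChain ω₂ lam β γ).IsSteadyState N T_L T_R μ → (Literature.MathematicalPhysics.KineticTheory.HeatConduction.pinnedChain ω₂ lam β γ).IsSteadyState N T_L T_R ν → μ = ν) → ∀ μ : (N : ℕ) → ℝ → ℝ → MeasureTheory.Measure (Literature.MathematicalPhysics.KineticTheory.HeatConduction.PhaseSpace N), (∀ (N : ℕ) (T_L T_R : ℝ), 0 < T_L → 0 <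 T_R → (Literature.MathematicalPhysics.KineticTheory.HeatConduction.pinnedChain ω₂ lam β γ).IsSteadyState N T_L T_R (μ N T_L T_R)) → ∀ T : ℝ, 0 < T → ∀ G : ℕ → ℝ, (∀ N : ℕ, 2 ≤ N → Filter.Tendsto (fun δ : ℝ => (Literature.MathematicalPhysics.KineticTheory.HeatConduction.pinnedChain ω₂ lam β γ).totalCurrent (μ N (T + δ / 2) (T - δ / 2)) / (((N : ℝ) - 1) * δ)) (nhdsWithin 0 {(0 : ℝ)}ᶜ) (nhds (G N))) → Filter.Tendsto G Filter.atTop (nhds 0)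

/-- item stmt-AtomisticToContinuum-0717 · support · rank 9 · closed · proved by Summit.AtomisticToContinuum.FouriersLaw.Theorems.FourierGreenKubo.finiteResponseOfUnique_holds (prover) · by planner
sources: ReyBellet2003, HairerMajda2009, CuneoEckmannHairerReyBellet2018
CONDITIONAL FORM OF 0705 (supersedes it as the prover target; refuters pool-5/g3-0: 0705 stand-alone
quantifies over EVERY steady-state family and is false-prone if weak steady states were non-unique):
assuming UNIQUENESS of weak steady states (IsSteadyState class) for pinnedChain at all N, T_L, T_R >
0, the finite-N linear-response limit D_N(T) = lim_{δ→0, δ≠0} totalCurrent(μ_{N,T+δ/2,T−δ/2})/δ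
exists for every T > 0 and N. Content: differentiability at equilibrium of NESS expectations of the
polynomial currents in the bath temperatures (ReyBellet2003 arXiv:math-ph/0303021 Rem 4.4 (51)–(56)
finite-volume Green–Kubo; HairerMajda2009 arXiv:0909.4313 Thm 2.3 framework — their SDE Thm 4.4
Assumption 5 fails here, so verify Assumptions 1–3 via CEHR2018 (2.5)/Carmona2007 Thm 1.1(iv)
weighted spectral gap). N = 0, 1: totalCurrent ≡ 0, D = 0. Together with 0706 gives 0705. -/
@[route_item "route-AtomisticToContinuum-ParabolicBathMap", crux]
def FiniteResponseOfUnique : Prop :=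
  ∀ ω₂ lam β γ : ℝ, 0 < ω₂ → 0 < lam → 0 < β → 0 < γ → (∀ (N : ℕ) (T_L T_R : ℝ), 0 < T_L → 0 < T_R → ∀ μ ν : MeasureTheory.Measure (Literature.MathematicalPhysics.KineticTheory.HeatConduction.PhaseSpace N), (Literature.MathematicalPhysics.KineticTheory.HeatConduction.pinnedChain ω₂ lam β γ).IsSteadyState N T_L T_R μ → (Literature.MathematicalPhysics.KineticTheory.HeatConduction.pinnedChain ω₂ lam β γ).IsSteadyState N T_L T_R ν → μ = ν) → ∀ μ : (N : ℕ) → ℝ → ℝ → MeasureTheory.Measure (Literature.MathematicalPhysics.KineticTheory.HeatConduction.PhaseSpace N), (∀ (N : ℕ) (T_L T_R : ℝ), 0 < T_L → 0 < T_R → (Literature.MathematicalPhysics.KineticTheory.HeatConduction.pinnedChain ω₂ lam β γ).IsSteadyState N T_L T_R (μ N T_L T_R)) → ∀ T : ℝ, 0 < T → ∀ N : ℕ, ∃ D : ℝ, Filter.Tendsto (fun δ : ℝ => (Literature.MathematicalPhysics.KineticTheory.HeatConduction.pinnedChain ω₂ lam β γ).totalCurrent (μ N (T + δ / 2) (T -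 δ / 2)) / δ) (nhdsWithin 0 {(0 : ℝ)}ᶜ) (nhds D)

/-- `FiniteResponseOfUnique` holds: proved by `Summit.AtomisticToContinuum.FouriersLaw.Theorems.FourierGreenKubo.finiteResponseOfUnique_holds`. -/
theorem FiniteResponseOfUnique_holds : FiniteResponseOfUnique := _root_.Summit.AtomisticToContinuum.FouriersLaw.Theorems.FourierGreenKubo.finiteResponseOfUnique_holds

/-- item stmt-AtomisticToContinuum-0741 · support · rank 9 · closed · proved by Summit.AtomisticToContinuum.FouriersLaw.Theorems.nessUnique_proof (prover) · by planner
sources: CuneoEckmannHairerReyBellet2018, Carmona2007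
[crux] UNIQUENESS OF THE WEAK STEADY STATE (the half of stmt-0706 not covered by the landed fact
Literature.MathematicalPhysics.KineticTheory.HeatConduction.CuneoEckmannHairerReyBellet2018_pinnedChain,
p3544): for pinnedChain ω₂ lam β γ (all > 0), every N and T_L, T_R > 0, any two measures in the weak
Fokker–Planck class IsSteadyState (probability, ∫ L f dμ = 0 for f ∈ C_c^∞, bond currents
integrable) coincide. Print: uniqueness of the INVARIANT MEASURE of the Langevin semigroup
(CuneoEckmannHairerReyBellet2018 Thm 2.13(1): C1, C2, CA; Carmona2007 Thm 1.1(iii)); the item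
additionally needs 'weak stationary probability solution of L*μ = 0 ⇒ P_t-invariant' for this
hypoelliptic L with cubic drift (Echeverría 1982 well-posed martingale problem on C_c^∞ +
non-explosion via e^{θH}; Bogachev–Krylov–Röckner–Shaposhnikov 2015 Ch. 5 is non-degenerate only) —
the FP-identification lemma is the formal crux. N = 0: PhaseSpace 0 is a point (unique probability
measure); N = 1: both baths on site 0, OU at temperature (T_L+T_R)/2. This is exactly the hypothesis
of FiniteResponse and ThermodynamicLimit and, with the fact, gives clause (i) of FouriersLawFor. -/
@[route_item "route-AtomisticToContinuum-ParabolicBathMap", crux]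
def NessUnique : Prop :=
  ∀ ω₂ lam β γ : ℝ, 0 < ω₂ → 0 < lam → 0 < β → 0 < γ → ∀ (N : ℕ) (T_L T_R : ℝ), 0 < T_L → 0 < T_R → ∀ μ ν : MeasureTheory.Measure (Literature.MathematicalPhysics.KineticTheory.HeatConduction.PhaseSpace N), (Literature.MathematicalPhysics.KineticTheory.HeatConduction.pinnedChain ω₂ lam β γ).IsSteadyState N T_L T_R μ → (Literature.MathematicalPhysics.KineticTheory.HeatConduction.pinnedChain ω₂ lam β γ).IsSteadyState N T_L T_R ν → μ = ν

/-- `NessUnique` holds: proved by `Summit.AtomisticToContinuum.FouriersLaw.Theorems.nessUnique_proof`. -/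
theorem NessUnique_holds : NessUnique := _root_.Summit.AtomisticToContinuum.FouriersLaw.Theorems.nessUnique_proof

/-- item stmt-AtomisticToContinuum-11924 · support · rank 9 · open · by planner
sources: ReyBellet2003, EckmannPilletReyBellet1999b, CuneoEckmannHairerReyBellet2018
[support] (identical signature to retired stmt-3323) strict positivity of the finite-N conductance,
G_N(T) > 0 for all N ≥ 2, every steady-state family under uniqueness (non-degeneracy of the
finite-volume Kubo variance of the contact power w_L = γ(T − p_0²): w_L is not a coboundary L h with
∂_p h = 0 on the bath momenta). Print-level routine given the finite-volume Green–Kubo formula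
(ReyBellet2003 Rem 4.4 (56)) and strict entropy production (EckmannPilletReyBellet1999b); the Markov
semigroup of the chain is in tree (OscillatorChain.transitionKernel). Load-bearing: antecedent of
ResistanceQuantum and ParabolicGerm and hypothesis of `closes`. [difficulty: L] -/
@[route_item "route-AtomisticToContinuum-ParabolicBathMap", crux]
def OhmicSign : Prop :=
  ∀ ω₂ lam β γ : ℝ, 0 < ω₂ → 0 < lam → 0 < β → 0 < γ → (∀ (N : ℕ) (T_L T_R : ℝ), 0 < T_L → 0 < T_R → ∀ μ ν : MeasureTheory.Measure (Literature.MathematicalPhysics.KineticTheory.HeatConduction.PhaseSpace N), (Literature.MathematicalPhysics.KineticTheory.HeatConduction.pinnedChain ω₂ lam β γ).IsSteadyState N T_L T_R μ → (Literature.MathematicalPhysics.KineticTheory.HeatConduction.pinnedChain ω₂ lam β γ).IsSteadyState N T_L T_R ν → μ = ν) → ∀ μ : (N : ℕ) → ℝ → ℝ → MeasureTheory.Measure (Literature.MathematicalPhysics.KineticTheory.HeatConduction.PhaseSpace N), (∀ (N : ℕ) (T_L T_R : ℝ), 0 < T_L → 0 < T_R → (Literature.MathematicalPhysics.KineticTheory.HeatConduction.pinnedChain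 ω₂ lam β γ).IsSteadyState N T_L T_R (μ N T_L T_R)) → ∀ T : ℝ, 0 < T → ∀ G : ℕ → ℝ, (∀ N : ℕ, 2 ≤ N → Filter.Tendsto (fun δ : ℝ => (Literature.MathematicalPhysics.KineticTheory.HeatConduction.pinnedChain ω₂ lam β γ).totalCurrent (μ N (T + δ / 2) (T - δ / 2)) / (((N : ℝ) - 1) * δ)) (nhdsWithin 0 {(0 : ℝ)}ᶜ) (nhds (G N))) → ∀ N : ℕ, 2 ≤ N → 0 < G N

/-- item stmt-AtomisticToContinuum-11925 · support · rank 9 · open · by planner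
sources: BonettoLebowitzReyBellet2000, CuneoEckmannHairerReyBellet2018
[support] (glue of the foreseen split ParabolicGerm ⇐ JunctionLocality → OrbitTail; provable now)
JunctionLocality → ResistanceQuantum ∧ ParabolicGerm: write N = n+1; E_n :=
ChainEnvironment.standard U V γ n is Φ^[n](bath γ) (iterate_attach_bath) and its composite IS the
(n+1)-chain (composite_standard), so by hasConductance_standard_iff and uniqueness (families agree
for |δ| < 2T, limits along 𝓝[≠]0 coincide) the conductance of E_n exists and equals G_{n+1}; G → 0
puts E_n in nearlyClosed m g₀ for large n (standard_mem_nearlyClosed_iff), E_n.attach = E_{n+1}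
(attach_standard), positivity from the antecedent; hence eventually |1/G_{N+1} − 1/G_N − r| ≤ ε:
increments → r (ParabolicGerm) and eventually ≥ r/2 =: a (ResistanceQuantum). Bridges elaborated in
the planner folder (CheckBridge.lean rc 0). [difficulty: provable-now] -/
@[route_item "route-AtomisticToContinuum-ParabolicBathMap"]
def LocalityTransfer : Prop :=
  JunctionLocality → ResistanceQuantum ∧ ParabolicGerm

/-- item stmt-AtomisticToContinuum-14180 · support · rank 9 · open · by planner
[support][glue] OhmicSign → Recurrence → ResistanceQuantum → ParabolicGerm → BathOrbitParabolic: the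
orbit statements conclude the target X (route-choice repair of `route.target-unreachable`, option
(a); same shape as EscapeLawOfCruxes / SandwichGlue on this sub-problem). PROVED in the planner
folder (Sketch.lean, lean check rc 0, 0 sorries, axioms propext/Classical.choice/Quot.sound, ~25
lines of logic): fix parameters > 0, the uniqueness hypothesis and T > 0; take r from ParabolicGerm
(∃ r ∀ family) and a > 0 from ResistanceQuantum; classical case split — if SOME steady-state family
μ admits a conductance sequence G (N ≥ 2), then Recurrence gives G → 0 and OhmicSign gives G_N > 0,
so ParabolicGerm gives increments 1/G_{N+1} − 1/G_N → r and ResistanceQuantum gives eventually a ≤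
increments, hence r ≥ a > 0 (ge_of_tendsto), and for EVERY family and conductance sequence the
increments → r by ParabolicGerm again (antecedents from Recurrence, OhmicSign); otherwise r := 1 and
the universal conclusion is vacuous. Neither NessUnique, FiniteResponseOfUnique nor the existence
theorem pinnedChain_exists_isSteadyState is an antecedent (STEP A of `closes` used the canonical
family instead; th -/
@[route_item "route-AtomisticToContinuum-ParabolicBathMap"]
def BathOrbitParabolicOfCruxes : Prop :=
  OhmicSign → Recurrence → ResistanceQuantum → ParabolicGerm → BathOrbitParabolic

/-- item stmt-AtomisticToContinuum-11926 · assembly · rank 1 · open · by planner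
sources: BonettoLebowitzReyBellet2000, CuneoEckmannHairerReyBellet2018
[assembly] NessUnique → FiniteResponseOfUnique → OhmicSign → Recurrence → ResistanceQuantum →
ParabolicGerm → FouriersLaw (the sub-problem Statement decl; proof = `closes`). -/
@[route_item "route-AtomisticToContinuum-ParabolicBathMap"]
def Assembly : Prop :=
  NessUnique → FiniteResponseOfUnique → OhmicSign → Recurrence → ResistanceQuantum → ParabolicGerm → FouriersLaw

/-! D-0027 §2.1 — DECIDING THEOREM (planner-authored via `route open/edit --closes-file`; by planner-plancard-AtomisticToContinuum-Fourier-74caf047-g2-0 2026-08-15T18:46:03Z):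
its hypotheses are this route's items and its conclusion the sub-problem Statement (glue_lint), and it elaborates with this file. -/

/-- D-0027 §2.1 deciding theorem for route ParabolicBathMap: the route's items imply the sub-problem
Statement `FouriersLaw` (Summits/AtomisticToContinuum/FouriersLaw/Statement.lean). Clause (i) from the
PROVED `pinnedChain_exists_isSteadyState` + `NessUnique`; clause (ii): along the canonical family the
conductances `G_N = D_N/(N-1)` (from `FiniteResponseOfUnique`) are positive (`OhmicSign`) and tend to `0`
(`Recurrence`), so `ResistanceQuantum` and `ParabolicGerm` give resistance increments `→ r ≥ a > 0`;
`κ(T) := 1/r`; for an arbitrary family the increments tend to the same `r` (ParabolicGerm's `∃ r ∀ family`),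
and Cesàro (`Filter.Tendsto.cesaro` on the telescoping sum) turns `(G_(N+1))⁻¹ - (G_N)⁻¹ → r` into
`D_N = (N-1) G_N → 1/r`. (planner; pure real analysis) -/
@[closes "route-AtomisticToContinuum-ParabolicBathMap"] theorem closes (hU : NessUnique) (hF : FiniteResponseOfUnique) (hO : OhmicSign) (hRec : Recurrence)
    (hQ : ResistanceQuantum) (hP : ParabolicGerm) : FouriersLaw := by
  show Literature.MathematicalPhysics.KineticTheory.HeatConduction.FouriersLaw
  unfold Literature.MathematicalPhysics.KineticTheory.HeatConduction.FouriersLaw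
  intro ω₂ lam β γ hω hl hβ hγ
  have hUq := hU ω₂ lam β γ hω hl hβ hγ
  have hex : ∀ (N : ℕ) (T_L T_R : ℝ), 0 < T_L → 0 < T_R →
      ∃ μ : MeasureTheory.Measure (Literature.MathematicalPhysics.KineticTheory.HeatConduction.PhaseSpace N), (Literature.MathematicalPhysics.KineticTheory.HeatConduction.pinnedChain ω₂ lam β γ).IsSteadyState N T_L T_R μ :=
    fun N T_L T_R h1 h2 => Literature.MathematicalPhysics.KineticTheory.HeatConduction.pinnedChain_exists_isSteadyState hω hl hβ hγ N h1 h2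
  unfold Literature.MathematicalPhysics.KineticTheory.HeatConduction.OscillatorChain.FouriersLawFor
  refine ⟨fun N T_L T_R h1 h2 => ?_, ?_⟩
  · obtain ⟨μ, hμ⟩ := hex N T_L T_R h1 h2
    exact ⟨μ, hμ, fun ν hν => hUq N T_L T_R h1 h2 ν μ hν hμ⟩
  classical
  -- the canonical steady-state family (choice)
  let μ₀ : (N : ℕ) → ℝ → ℝ → MeasureTheory.Measure (Literature.MathematicalPhysics.KineticTheory.HeatConduction.PhaseSpace N) :=
    fun N T_L T_R => if h : 0 < T_L ∧ 0 < T_R then Classical.choose (hex N T_L T_R h.1 h.2) else 0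
  have hμ₀ : ∀ (N : ℕ) (T_L T_R : ℝ), 0 < T_L → 0 < T_R → (Literature.MathematicalPhysics.KineticTheory.HeatConduction.pinnedChain ω₂ lam β γ).IsSteadyState N T_L T_R (μ₀ N T_L T_R) := by
    intro N T_L T_R h1 h2
    have h12 : 0 < T_L ∧ 0 < T_R := ⟨h1, h2⟩
    simp only [μ₀, dif_pos h12]
    exact Classical.choose_spec (hex N T_L T_R h1 h2)
  -- response sequences exist along every admissible family (FiniteResponseOfUnique)
  have hD : ∀ μ : (N : ℕ) → ℝ → ℝ → MeasureTheory.Measure (Literature.MathematicalPhysics.KineticTheory.HeatConduction.PhaseSpace N),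
      (∀ (N : ℕ) (T_L T_R : ℝ), 0 < T_L → 0 < T_R → (Literature.MathematicalPhysics.KineticTheory.HeatConduction.pinnedChain ω₂ lam β γ).IsSteadyState N T_L T_R (μ N T_L T_R)) →
      ∀ T : ℝ, 0 < T → ∃ D : ℕ → ℝ, ∀ N : ℕ,
        Filter.Tendsto (fun δ : ℝ => (Literature.MathematicalPhysics.KineticTheory.HeatConduction.pinnedChain ω₂ lam β γ).totalCurrent (μ N (T + δ / 2) (T - δ / 2)) / δ)
          (nhdsWithin 0 {(0 : ℝ)}ᶜ) (nhds (D N)) := by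
    intro μ hμ T hT
    choose D hD' using fun N => hF ω₂ lam β γ hω hl hβ hγ hUq μ hμ T hT N
    exact ⟨D, hD'⟩
  -- a response sequence yields a conductance sequence G N = D N / (N - 1), N ≥ 2
  have hG : ∀ μ : (N : ℕ) → ℝ → ℝ → MeasureTheory.Measure (Literature.MathematicalPhysics.KineticTheory.HeatConduction.PhaseSpace N), ∀ T : ℝ, ∀ D : ℕ → ℝ,
      (∀ N : ℕ, Filter.Tendsto (fun δ : ℝ => (Literature.MathematicalPhysics.KineticTheory.HeatConduction.pinnedChain ω₂ lam β γ).totalCurrent (μ N (T + δ / 2) (T - δ / 2)) / δ)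
          (nhdsWithin 0 {(0 : ℝ)}ᶜ) (nhds (D N))) →
      ∀ N : ℕ, 2 ≤ N → Filter.Tendsto (fun δ : ℝ => (Literature.MathematicalPhysics.KineticTheory.HeatConduction.pinnedChain ω₂ lam β γ).totalCurrent (μ N (T + δ / 2) (T - δ / 2)) / (((N : ℝ) - 1) * δ))
          (nhdsWithin 0 {(0 : ℝ)}ᶜ) (nhds (D N / ((N : ℝ) - 1))) := by
    intro μ T D hDl N hN
    refine ((hDl N).div_const ((N : ℝ) - 1)).congr' (Filter.Eventually.of_forall fun δ => ?_)
    rw [div_div, mul_comm]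
  -- STEP A: for every T > 0 one r > 0 governs the resistance increments along every admissible family
  have key : ∀ T : ℝ, 0 < T → ∃ r : ℝ, 0 < r ∧ ∀ μ : (N : ℕ) → ℝ → ℝ → MeasureTheory.Measure (Literature.MathematicalPhysics.KineticTheory.HeatConduction.PhaseSpace N),
      (∀ (N : ℕ) (T_L T_R : ℝ), 0 < T_L → 0 < T_R → (Literature.MathematicalPhysics.KineticTheory.HeatConduction.pinnedChain ω₂ lam β γ).IsSteadyState N T_L T_R (μ N T_L T_R)) →
      ∀ G : ℕ → ℝ, (∀ N : ℕ, 2 ≤ N → Filter.Tendsto (fun δ : ℝ => (Literature.MathematicalPhysics.KineticTheory.HeatConduction.pinnedChain ω₂ lam β γ).totalCurrent (μ N (T + δ / 2) (T - δ / 2)) / (((N : ℝ) - 1) * δ))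
          (nhdsWithin 0 {(0 : ℝ)}ᶜ) (nhds (G N))) →
      Filter.Tendsto (fun N : ℕ => (G (N + 1))⁻¹ - (G N)⁻¹) Filter.atTop (nhds r) := by
    intro T hT
    obtain ⟨r, hr⟩ := hP ω₂ lam β γ hω hl hβ hγ hUq T hT
    obtain ⟨a, ha, hQa⟩ := hQ ω₂ lam β γ hω hl hβ hγ hUq T hT
    obtain ⟨D, hDl⟩ := hD μ₀ hμ₀ T hT
    have hGc := hG μ₀ T D hDl
    have hpos : ∀ N : ℕ, 2 ≤ N → 0 < (fun N : ℕ => D N / ((N : ℝ) - 1)) N :=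
      hO ω₂ lam β γ hω hl hβ hγ hUq μ₀ hμ₀ T hT (fun N : ℕ => D N / ((N : ℝ) - 1)) hGc
    have hrec : Filter.Tendsto (fun N : ℕ => D N / ((N : ℝ) - 1)) Filter.atTop (nhds 0) :=
      hRec ω₂ lam β γ hω hl hβ hγ hUq μ₀ hμ₀ T hT (fun N : ℕ => D N / ((N : ℝ) - 1)) hGc
    have hinc := hr μ₀ hμ₀ (fun N : ℕ => D N / ((N : ℝ) - 1)) hGc hrec hpos
    have hev := hQa μ₀ hμ₀ (fun N : ℕ => D N / ((N : ℝ) - 1)) hGc hrec hpos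
    have har : a ≤ r := ge_of_tendsto hinc hev
    refine ⟨r, lt_of_lt_of_le ha har, fun μ hμ G hGμ => ?_⟩
    exact hr μ hμ G hGμ (hRec ω₂ lam β γ hω hl hβ hγ hUq μ hμ T hT G hGμ)
      (hO ω₂ lam β γ hω hl hβ hγ hUq μ hμ T hT G hGμ)
  -- STEP B: κ(T) := 1/r(T); Cesàro on the telescoping sum of increments
  choose! rT hrT using key
  refine ⟨fun T => (rT T)⁻¹, fun T hT => inv_pos.mpr (hrT T hT).1, ?_⟩
  intro μ hμ T hT
  obtain ⟨D, hDl⟩ := hD μ hμ T hT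
  refine ⟨D, hDl, ?_⟩
  have hr0 : 0 < rT T := (hrT T hT).1
  have hinc : Filter.Tendsto (fun N : ℕ => ((fun N : ℕ => D N / ((N : ℝ) - 1)) (N + 1))⁻¹ -
      ((fun N : ℕ => D N / ((N : ℝ) - 1)) N)⁻¹) Filter.atTop (nhds (rT T)) :=
    (hrT T hT).2 μ hμ (fun N : ℕ => D N / ((N : ℝ) - 1)) (hG μ T D hDl)
  -- real analysis: increments of 1/G → r > 0 ⇒ (N - 1) · G N → 1/r
  set G : ℕ → ℝ := fun N : ℕ => D N / ((N : ℝ) - 1) with hGdef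
  have hsum : ∀ n : ℕ, ∑ i ∈ Finset.range n, ((G (i + 1))⁻¹ - (G i)⁻¹) = (G n)⁻¹ - (G 0)⁻¹ :=
    fun n => Finset.sum_range_sub (fun i => (G i)⁻¹) n
  have h1 : Filter.Tendsto (fun n : ℕ => (n : ℝ)⁻¹ * ((G n)⁻¹ - (G 0)⁻¹)) Filter.atTop (nhds (rT T)) := by
    refine hinc.cesaro.congr (fun n => ?_)
    rw [hsum]
  have h2 : Filter.Tendsto (fun n : ℕ => (n : ℝ)⁻¹ * (G n)⁻¹) Filter.atTop (nhds (rT T)) := by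
    have h0 : Filter.Tendsto (fun n : ℕ => (n : ℝ)⁻¹ * (G 0)⁻¹) Filter.atTop (nhds 0) := by
      simpa using (tendsto_inv_atTop_nhds_zero_nat (𝕜 := ℝ)).mul_const ((G 0)⁻¹)
    have h10 := h1.add h0
    rw [add_zero] at h10
    refine h10.congr (fun n => ?_)
    ring
  have h3 : Filter.Tendsto (fun n : ℕ => (n : ℝ) * G n) Filter.atTop (nhds (rT T)⁻¹) := by
    refine (h2.inv₀ hr0.ne').congr (fun n => ?_)
    rw [mul_inv, inv_inv, inv_inv]
  have h4 : Filter.Tendsto G Filter.atTop (nhds 0) := by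
    have h30 := h3.mul (tendsto_inv_atTop_nhds_zero_nat (𝕜 := ℝ))
    rw [mul_zero] at h30
    refine h30.congr' ?_
    filter_upwards [Filter.eventually_gt_atTop 0] with n hn
    have hn' : (n : ℝ) ≠ 0 := by positivity
    field_simp
  have h5 : Filter.Tendsto (fun n : ℕ => ((n : ℝ) - 1) * G n) Filter.atTop (nhds (rT T)⁻¹) := by
    have h34 := h3.sub h4
    rw [sub_zero] at h34
    refine h34.congr (fun n => ?_)
    ring
  refine h5.congr' ?_
  filter_upwards [Filter.eventually_ge_atTop 2] with N hN
  have hN1 : ((N : ℝ) - 1) ≠ 0 := by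
    have : (2 : ℝ) ≤ N := by exact_mod_cast hN
    linarith
  rw [hGdef]
  field_simp

end Summit.AtomisticToContinuum.FouriersLaw.Theses.ParabolicBathMap
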